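import Literature.Probability.LatticeModels.SharpnessSubcritical
import Literature.Probability.LatticeModels.PlusStateFKG
import Literature.Probability.LatticeModels.GriffithsKellySherman
import HarnessLib

/-!
# The mean-field lower bound `m*(β) ≥ c (β - β_c)^{1/2}`: the supercritical half of Duminil-Copin–Tassion

Trunk G02 (T-STATMECH), topic `Probability/LatticeModels`, namespace `Literature.CritIsing`. Sibling
proof file of `Literature.Probability.LatticeModels.Sharpness`, complementing
`Literature.Probability.LatticeModels.SharpnessSubcritical` (the subcritical half of the same
argument). Its purpose is the discharge of the named fact `Literature.Probability.LatticeModels.meanField_lower_bound`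
(crit-ising.S08, Aizenman–Barsky–Fernández 1987, Thm. 1 (ii); Duminil-Copin–Tassion 2016,
Thm. 1.2): for the nearest-neighbour Ising model on `ℤ^d`, `d ≥ 2`, there are `c > 0`, `ε > 0`
with `m*(β) ≥ c (β - β_c)^{1/2}` for `β ∈ (β_c, β_c + ε)`.

The printed source is H. Duminil-Copin, V. Tassion, *A new proof of the sharpness of the phase
transition for Bernoulli percolation and the Ising model*, Comm. Math. Phys. **343** (2016)
725–745 (bib key `DuminilCopinTassionCMP2016`), read in the held arXiv rendering
`arXiv:1502.03050` whose numbering is used for inner locators (§2, Thm. 2.1 = Thm. 1.2 of the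
journal version, eq. (2.1) = `φ_β(S)`, §2.4 (Lemma 2.6, eq. (2.6)), §2.5 (Lemma 2.7)).

## The architecture (DCT §2.1) and the division of labour in the tree

With `φ_β(S)` (`dctIsingPhi`, defined in `SharpnessSubcritical`) and
`β̃_c = sup {β ≥ 0 | φ_β(S) < 1 for some finite S ∋ 0}`, DCT prove the three items of Thm. 2.1
*with `β̃_c` in place of `β_c`*, "which directly implies `β̃_c = β_c`":

* §2.4 (eq. (2.6), from Lemma 2.6 — to be read with the boundary correction of CMP 359 (2018)
  821: as printed in arXiv:1502.03050, Lemma 2.6 omits the bonds leaving `Λ` when `φ_β(S)` is made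
  to appear on p. 10, and fails e.g. for `Λ = {0}` — integrated between `β̃_c` and `β`,
  `Λ ↑ ℤ^d`, `h ↘ 0`): `m*(β) ≥ √((β² - β̃_c²)/β²)` for `β ≥ β̃_c`. This is the named fact
  `dct_magnetization_lower_bound` **of `SharpnessSubcritical`** (stated there with "`β₁ ≥ β̃_c`"
  unfolded), the single §2.4 residue of the tree, used here as the hypothesis `hmag`; it is
  decomposed and reduced to named facts (the corrected Lemma 2.6, the vanishing of its boundary
  term, GHS concavity, `lim_{h↘0}⟨σ₀⟩_{β,h} = m*`) in `MeanFieldLowerBound`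
  (`dct_magnetization_lower_bound_of_facts`), so that the two halves of S08 compose.
* §2.5 (from Lemma 2.7): if `φ_β(S) < 1` for some finite `S ∋ 0` then `⟨σ₀σ_x⟩⁺_β` decays
  exponentially. The *plus-state* form is what "`β̃_c ≤ β_c`" needs (via
  `m*(β)² ≤ ⟨σ₀σ_x⟩⁺_{β,0}`); it is vendored here as the named fact
  `dct_twoPointPlus_exponentialDecay` and proved from the plus-state Lemma 2.7 in
  `MeanFieldBoundProofs`. (The tree's `ModifiedSimonInequality` proves Lemma 2.7 in finite volume
  at zero field, which yields the decay of the *free* two-point function used by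
  `SharpnessSubcritical`; the plus-state statement needs the field `h ↘ 0` version of the source.)

## Contents

Definitions: `dctIsingSet d = {β ≥ 0 | ∃ S ∋ 0 finite, φ_β(S) < 1}`,
`dctIsingCriticalBeta d = β̃_c = sSup (dctIsingSet d)` (DCT §2.1).

Named fact: `dct_twoPointPlus_exponentialDecay` (DCT §2.5 with `β̃_c`, plus state, prefactor form).

Proved: `β ↦ φ_β(S)` nondecreasing (`dctIsingPhi_mono`, from the tree theorem `gks_two_holds` via
`SharpnessSubcritical.isingCorr_free_mono_beta`, discharged here as `isingCorr_free_mono_beta_holds`)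
and `dctIsingSet d` an initial segment; `m*(0) = 0`; `β ∈ dctIsingSet ⇒ m*(β) = 0` (from the
§2.5 fact, FKG in the plus state and `⟨σ_x⟩⁺ = m*`); eq. (2.6) above `β̃_c` from
`dct_magnetization_lower_bound` (`dct_spontaneousMagnetization_lower_bound`); `β̃_c < ∞` for
`d ≥ 2` (Peierls); `β̃_c = β_c`; and the target:
`meanField_lower_bound_of_dct` (hypotheses threaded) / `meanField_lower_bound_of_dct_facts`
(remaining hypotheses: `dct_magnetization_lower_bound`, `dct_twoPointPlus_exponentialDecay`,
`exists_spontaneousMagnetization_pos`), with `ε = 1`, `c = 1/√(β_c + 1)`: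
`m*(β) ≥ √((β²-β_c²)/β²) ≥ √(β-β_c)/√(β_c+1)` on `(β_c, β_c + 1)`; and the variant
`meanField_lower_bound_of_zero_on_dctIsingSet` in which the §2.5 fact is replaced by its only
use, "`m* = 0` on `dctIsingSet d`" (any route to `β̃_c ≤ β_c`).

## Design and faithfulness notes

* `β̃_c` is a real `sSup`; DCT's `β̃_c ∈ [0, ∞]`. `dctIsingSet d ∋ 0` always; when it is unbounded
  (e.g. `d = 1`) statements about `β > β̃_c` are empty and carry `BddAbove (dctIsingSet d)`;
  `bddAbove_dctIsingSet` proves boundedness for `d ≥ 2`.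
* DCT's `⟨·⟩⁺_β`, "the weak limit of `⟨·⟩_{β,h}` as `h ↘ 0`", is the plus state at zero field,
  the tree's `plusExpect d β 0` / `twoPointPlus d β` (Friedli–Velenik 2017, Exercise 3.31 with the
  double monotone limit of the proof of Lemma 3.31 (1); Remark 3.30 / Thm. 3.46 for `σ₀`).
* DCT's graph distance `d(0,x)` on `ℤ^d` is the `ℓ¹` norm `≥ ‖x‖` (sup norm), so the decay
  `e^{-c d(0,x)}` printed in Thm. 2.1 implies the sup-norm form vendored here.
* The target `meanField_lower_bound` is NOT mis-stated (tree `β_c = inf{β ≥ 0 | m*(β) > 0}` =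
  DCT's `β_c` under the identification above).

## References

* H. Duminil-Copin, V. Tassion, Comm. Math. Phys. 343 (2016) 725–745 (arXiv:1502.03050), §2.
* M. Aizenman, D. J. Barsky, R. Fernández, J. Stat. Phys. 47 (1987) 343–374, Thm. 1.
* S. Friedli, Y. Velenik, *Statistical Mechanics of Lattice Systems* (CUP 2017), Ch. 3
  (Def. 3.32, Remark 3.30, Remark 3.33, Lemma 3.31, Exercises 3.9, 3.31).
-/

noncomputable section

open MeasureTheory Filter Topology Finset Literature.Probability.LatticeModels Literature.Probability.Percolation

namespace Literature.Probability.LatticeModels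

open Percolation

variable (d : ℕ)

/-! ### DCT's `β̃_c` (with `φ_β(S) = dctIsingPhi d β S` from `SharpnessSubcritical`) -/

/-- The set `{β ≥ 0 | φ_β(S) < 1 for some finite S ⊂ ℤ^d containing 0}` whose supremum is
Duminil-Copin–Tassion's `β̃_c` (CMP 343 (2016), §2.1, display after eq. (13)). [cite: DuminilCopinTassionCMP2016, §2.1, definition of β̃_c] -/
def dctIsingSet : Set ℝ :=
  {β | 0 ≤ β ∧ ∃ S : Finset (Site d), (0 : Site d) ∈ S ∧ dctIsingPhi d β S < 1}

/-- **Duminil-Copin–Tassion's `β̃_c`** `= sup {β ≥ 0 : φ_β(S) < 1 for some finite S ∋ 0}`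
(CMP 343 (2016), §2.1, display after eq. (13)), as a real `sSup`. **Junk value** `0` when
`dctIsingSet d` is not bounded above (the source's `β̃_c = +∞`, e.g. for `d = 1`); statements using
it carry `BddAbove (dctIsingSet d)`, proved for `d ≥ 2` in `Literature.Probability.LatticeModels.bddAbove_dctIsingSet`. The set is
never empty (`zero_mem_dctIsingSet`). [cite: DuminilCopinTassionCMP2016, §2.1, definition of β̃_c] -/
def dctIsingCriticalBeta : ℝ :=
  sSup (dctIsingSet d)

/-- At `β = 0` every term of `φ_β(S)` vanishes (`tanh 0 = 0`): `φ₀(S) = 0`. [folklore] -/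
@[simp] theorem dctIsingPhi_zero_left (S : Finset (Site d)) : dctIsingPhi d 0 S = 0 := by
  simp [dctIsingPhi, Real.tanh_zero]

/-- `0 ∈ dctIsingSet d`: `φ₀({0}) = 0 < 1`. [folklore] -/
theorem zero_mem_dctIsingSet : (0 : ℝ) ∈ dctIsingSet d :=
  ⟨le_rfl, {0}, mem_singleton_self 0, by rw [dctIsingPhi_zero_left]; exact zero_lt_one⟩

/-- `dctIsingSet d` is nonempty (it contains `0`). [folklore] -/
theorem dctIsingSet_nonempty : (dctIsingSet d).Nonempty :=
  ⟨0, zero_mem_dctIsingSet d⟩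

/-- `β̃_c ≥ 0` (all members of `dctIsingSet d` are `≥ 0`; also for the junk value `sSup = 0`).
(Duminil-Copin–Tassion 2016, §2.1.) [cite: DuminilCopinTassionCMP2016, §2.1] -/
theorem dctIsingCriticalBeta_nonneg : 0 ≤ dctIsingCriticalBeta d :=
  Real.sSup_nonneg fun _ hβ => hβ.1

/-- If `dctIsingSet d` is bounded above, its members are `≤ β̃_c`. [folklore] -/
theorem le_dctIsingCriticalBeta_of_mem (hD : BddAbove (dctIsingSet d)) {β : ℝ} (hβ : β ∈ dctIsingSet d) :
    β ≤ dctIsingCriticalBeta d :=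
  le_csSup hD hβ


variable {d}

/-- Above `β̃_c` no finite `S ∋ 0` has `φ_β(S) < 1` (definition of `β̃_c` as a supremum, for
`dctIsingSet d` bounded above). [cite: DuminilCopinTassionCMP2016, §2.1, definition of β̃_c] -/
theorem one_le_dctIsingPhi_of_lt (hD : BddAbove (dctIsingSet d)) {β : ℝ}
    (hβc : dctIsingCriticalBeta d < β) (S : Finset (Site d)) (h0 : (0 : Site d) ∈ S) :
    1 ≤ dctIsingPhi d β S := by
  by_contra hlt
  push Not at hlt
  have hβ0 : 0 ≤ β := (dctIsingCriticalBeta_nonneg d).trans hβc.le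
  have : β ≤ dctIsingCriticalBeta d := le_csSup hD ⟨hβ0, S, h0, hlt⟩
  linarith

/-! ### The §2.5 fact: exponential decay of `⟨σ₀σ_x⟩⁺` from the finite-size criterion -/

/-- **Duminil-Copin–Tassion 2016, §2.5, exponential decay from the finite-size criterion**
(CMP 343 (2016), Thm. 1.2 (1) / arXiv:1502.03050 Thm. 2.1, third item, proved in §2.5 with
`β̃_c` in place of `β_c`: "Let `β < β̃_c`. Fix a finite set `S` such that `φ_β(S) < 1`. … Let
`R` be the range of the `(J_{x,y})`, and let `L` be such that `S ⊂ Λ_{L-R}`. Lemma 2.7 implies …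
The proof follows by iterating `⌊n/L⌋` times this strategy", giving
`⟨σ₀σ_x⟩⁺_β ≤ e^{-c d(0,x)}` for all `x`, with `c = c(β) > 0`; the argument uses only the finite
set `S ∋ 0` with `φ_β(S) < 1`). Rendered for the nearest-neighbour model on `ℤ^d`, `d ≥ 1`,
`β > 0`: DCT's `⟨σ₀σ_x⟩⁺_β` (the `h ↘ 0` limit of the infinite-volume states `⟨·⟩_{β,h}`) is the
plus state at zero field, the tree's `twoPointPlus d β x = ⟨σ₀σ_x⟩⁺_{β,0}` (Friedli–Velenik 2017,
Exercise 3.31: `h ↦ ⟨σ_A⟩⁺_{Λ;β,h}` is nondecreasing, with the double monotone limit argument of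
the proof of Lemma 3.31 (1); for `σ₀` alone this is Remark 3.30 / Thm. 3.46), and DCT's graph
distance `d(0,x) = ‖x‖₁ ≥ ‖x‖` (sup norm). **Shape of
the bound.** Thm. 2.1 prints `⟨σ₀σ_x⟩⁺_β ≤ e^{-c d(0,x)}`; the printed iteration of §2.5 yields
exactly `⟨σ₀σ_x⟩⁺_β ≤ φ_β(S)^{⌊d(0,x)/L⌋}` (a bound `≤ 1` for `d(0,x) < L`), i.e. exponential decay
*up to a constant prefactor* `C = C(β, S)`, which is the form vendored here (it is what §2.5
proves and all that "items 2–3 imply `β_c ≥ β̃_c`" uses; the prefactor-free form additionally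
needs `⟨σ₀σ_x⟩⁺_β < 1` uniformly on the finite ball `d(0,x) < L`). [cite: DuminilCopinTassionCMP2016, §2.5, proof of Thm. 2.1 items 2–3 (arXiv numbering), Lemma 2.7] -/
def dct_twoPointPlus_exponentialDecay : Prop :=
  ∀ (_ : 1 ≤ d) ⦃β : ℝ⦄, 0 < β → ∀ S : Finset (Site d), (0 : Site d) ∈ S → dctIsingPhi d β S < 1 →
    ∃ c > 0, ∃ C : ℝ, ∀ x : Site d, twoPointPlus d β x ≤ C * Real.exp (-c * ‖x‖)

/-! ### Monotonicity of `φ_β(S)` in `β` (from GKS II) and the initial segment `dctIsingSet d` -/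

/-- **Friedli–Velenik 2017, Exercise 3.9 / 3.31 on `ℤ^d` (`β ↦ ⟨σ_A⟩^∅_{Λ;β,0}` nondecreasing on
`[0,∞)`), the named fact `isingCorr_free_mono_beta` of `SharpnessSubcritical`, discharged
unconditionally** from the tree theorem `gks_two_holds` (`GriffithsKellySherman`) via
`SharpnessSubcritical.isingCorr_free_mono_beta_of_gks_two` /
`GriffithsMonotonicity.monotoneOn_isingCorr_free`. [cite: FriedliVelenik2017, Exercise 3.9 with Thm. 3.20] -/
theorem isingCorr_free_mono_beta_holds : isingCorr_free_mono_beta (d := d) :=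
  isingCorr_free_mono_beta_of_gks_two fun _ _ _ _ _ _ => Literature.Probability.LatticeModels.GriffithsKellySherman.gks_two_holds (zdGraph d)

/-- **`β ↦ φ_β(S)` is nondecreasing on `[0, ∞)`** (for `S ∋ 0`), granting the monotonicity of the
free correlations in `β` (Friedli–Velenik 2017, Exercise 3.31) and the first Griffiths
inequality (`gks_one`): each term `tanh(β) ⟨σ₀σ_x⟩^∅_{S;β,0}` is a product of two nonnegative
nondecreasing functions of `β`. (Used implicitly in Duminil-Copin–Tassion 2016, §2.5: "Let
`β < β̃_c`. Fix a finite set `S` such that `φ_β(S) < 1`.") [cite: FriedliVelenik2017, Exercise 3.31 and Thm. 3.20] -/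
theorem dctIsingPhi_mono (hmono : isingCorr_free_mono_beta (d := d))
    (hgks : ∀ {Λ A : Finset (Site d)} {β h : ℝ} {bc : BoundaryCondition (Site d)},
      gks_one (zdGraph d) (Λ := Λ) (A := A) (β := β) (h := h) (bc := bc))
    {S : Finset (Site d)} (h0 : (0 : Site d) ∈ S) {β₁ β₂ : ℝ} (hβ₁ : 0 ≤ β₁) (h12 : β₁ ≤ β₂) :
    dctIsingPhi d β₁ S ≤ dctIsingPhi d β₂ S := by
  unfold dctIsingPhi
  refine sum_le_sum fun x hx => sum_le_sum fun y _ => ?_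
  have ht : Real.tanh β₁ ≤ Real.tanh β₂ := tanh_le_tanh h12
  have ht₂ : 0 ≤ Real.tanh β₂ := tanh_nonneg (hβ₁.trans h12)
  by_cases hx0 : x = 0
  · subst hx0
    simpa using ht
  · have hsub : ({0, x} : Finset (Site d)) ⊆ S := by
      intro z hz
      simp only [mem_insert, mem_singleton] at hz
      rcases hz with rfl | rfl
      · exact h0
      · exact hx
    rw [isingTwoPoint_eq_isingCorr _ _ _ _ _ (Ne.symm hx0),
      isingTwoPoint_eq_isingCorr _ _ _ _ _ (Ne.symm hx0)]
    have hc : isingCorr (zdGraph d) S β₁ 0 .free {0, x} ≤ isingCorr (zdGraph d) S β₂ 0 .free {0, x} :=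
      hmono S {0, x} hsub (Set.mem_Ici.2 hβ₁) (Set.mem_Ici.2 (hβ₁.trans h12)) h12
    have hc₁ : 0 ≤ isingCorr (zdGraph d) S β₁ 0 .free {0, x} :=
      hgks hβ₁ le_rfl (Or.inl rfl) hsub
    exact mul_le_mul ht hc hc₁ ht₂

/-- **`dctIsingSet d` is an initial segment of `[0, ∞)`**: if `φ_{β'}(S) < 1` and `0 ≤ β ≤ β'` then
`φ_β(S) ≤ φ_{β'}(S) < 1` (monotonicity of `φ` in `β`). [cite: DuminilCopinTassionCMP2016, §2.5 (first sentence of the conclusion of the proof)] -/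
theorem mem_dctIsingSet_of_le (hmono : isingCorr_free_mono_beta (d := d))
    (hgks : ∀ {Λ A : Finset (Site d)} {β h : ℝ} {bc : BoundaryCondition (Site d)},
      gks_one (zdGraph d) (Λ := Λ) (A := A) (β := β) (h := h) (bc := bc))
    {β β' : ℝ} (hβ' : β' ∈ dctIsingSet d) (hβ : 0 ≤ β) (hle : β ≤ β') : β ∈ dctIsingSet d := by
  obtain ⟨-, S, h0, hφ⟩ := hβ'
  exact ⟨hβ, S, h0, (dctIsingPhi_mono hmono hgks h0 hβ hle).trans_lt hφ⟩

/-! ### `m*(0) = 0` -/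

/-- At `β = 0` the tree's finite-volume Gibbs measure `isingMeasure G Λ 0 h bc` is the uniform
distribution on `{±1}^Λ` (glued to the boundary condition) for *every* `h`, because the field
enters the tree's weight `exp(-βH)` as `βh`; hence `isingExpect … Λ 0 h bc (σ_x) = 0` for `x ∈ Λ`
(flip the spin at `x`). (In Friedli–Velenik's own convention, eq. (3.8), `⟨σ_x⟩_{Λ;0,h} = tanh h`;
the statement below is about the tree's parametrisation and is used only at `h = 0`.) [cite: FriedliVelenik2017, §3.1, eq. (3.8)] -/
theorem isingExpect_spinAt_of_beta_zero (Λ : Finset (Site d)) (h : ℝ)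
    (bc : BoundaryCondition (Site d)) {x : Site d} (hx : x ∈ Λ) :
    isingExpect (zdGraph d) Λ 0 h bc (spinAt x) = 0 := by
  rw [isingExpect, integral_isingMeasure _ _ _ _ _ (measurable_spinAt x)]
  have hw : ∀ τ : Λ → ℤˣ, isingWeight (zdGraph d) Λ 0 h bc τ = 1 := fun τ => by
    simp [isingWeight]
  simp only [hw, one_mul]
  -- the spin flip at `x` is an involution of `Λ → ℤˣ` negating `σ_x`
  set i : Λ := ⟨x, hx⟩ with hi
  let e : (Λ → ℤˣ) ≃ (Λ → ℤˣ) :=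
    Function.Involutive.toPerm (fun τ => Function.update τ i (-τ i)) fun τ => by
      ext j
      by_cases hj : j = i
      · subst hj; simp
      · simp [Function.update_of_ne hj]
  have hsum : ∑ τ : Λ → ℤˣ, spinAt x (glue Λ τ bc) = -∑ τ : Λ → ℤˣ, spinAt x (glue Λ τ bc) := by
    calc ∑ τ : Λ → ℤˣ, spinAt x (glue Λ τ bc)
        = ∑ τ : Λ → ℤˣ, spinAt x (glue Λ (e τ) bc) := (Equiv.sum_comp e _).symm
      _ = ∑ τ : Λ → ℤˣ, -spinAt x (glue Λ τ bc) := by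
          refine sum_congr rfl fun τ _ => ?_
          simp only [spinAt, glue_apply_of_mem Λ _ bc hx]
          change (((Function.update τ i (-τ i)) i : ℤ) : ℝ) = -(((τ i : ℤˣ) : ℤ) : ℝ)
          simp
      _ = -∑ τ : Λ → ℤˣ, spinAt x (glue Λ τ bc) := by rw [sum_neg_distrib]
  have hzero : ∑ τ : Λ → ℤˣ, spinAt x (glue Λ τ bc) = 0 := by linarith
  rw [hzero, zero_div]

variable (d) in
/-- **`m*(0) = 0`**: at infinite temperature every finite-volume plus magnetisation vanishes
(`isingExpect_spinAt_of_beta_zero`), so the box limit `⟨σ₀⟩⁺_{0,0}` is `0`.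
(Friedli–Velenik 2017, §3.7; elementary.) [cite: FriedliVelenik2017, §3.7] -/
theorem spontaneousMagnetization_zero : spontaneousMagnetization d 0 = 0 := by
  change limUnder atTop (fun L : ℕ => isingExpect (zdGraph d) (box d L) 0 0 .plus (spinAt 0)) = 0
  have h : (fun L : ℕ => isingExpect (zdGraph d) (box d L) 0 0 .plus (spinAt 0)) = fun _ => 0 :=
    funext fun L => isingExpect_spinAt_of_beta_zero (box d L) 0 .plus (zero_mem_box d L)
  rw [h]
  exact tendsto_const_nhds.limUnder_eq

/-! ### `β ∈ dctIsingSet ⇒ m*(β) = 0` -/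

/-- **Exponential decay kills the magnetisation** (Duminil-Copin–Tassion 2016, §2.1: items 2–3
with `β̃_c` "directly imply" `β_c ≥ β̃_c`; Friedli–Velenik 2017, Remark 3.33:
`⟨σ₀σ_i⟩⁺_{β,0} ≥ m*(β)²`). Granting DCT's exponential decay from `φ_β(S) < 1`, FKG in the plus
state (`⟨σ₀⟩⁺⟨σ_x⟩⁺ ≤ ⟨σ₀σ_x⟩⁺`) and translation invariance (`⟨σ_x⟩⁺ = m*`): for `d ≥ 1`,
`β > 0` and a finite `S ∋ 0` with `φ_β(S) < 1`, `m*(β)² ≤ C e^{-c‖x‖}` for all `x`, and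
`‖(n,…,n)‖ = n → ∞` forces `m*(β) = 0`. [cite: DuminilCopinTassionCMP2016, §2.1 (β̃_c = β_c) with §2.5] -/
theorem spontaneousMagnetization_eq_zero_of_dctIsingPhi_lt_one (hd : 1 ≤ d)
    (hT2 : dct_twoPointPlus_exponentialDecay (d := d))
    (hfkg : plusExpect_spinAt_mul_le_plusPair (d := d))
    (hti : plusExpect_spinAt_eq_spontaneousMagnetization (d := d))
    {β : ℝ} (hβ : 0 < β) {S : Finset (Site d)} (h0 : (0 : Site d) ∈ S)
    (hφ : dctIsingPhi d β S < 1) : spontaneousMagnetization d β = 0 := by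
  obtain ⟨c, hc, C, hdec⟩ := hT2 hd hβ S h0 hφ
  set m := spontaneousMagnetization d β with hm
  have key : ∀ x : Site d, m * m ≤ C * Real.exp (-c * ‖x‖) := fun x => by
    have h := hfkg hβ.le 0 x
    rw [hti hβ.le 0, hti hβ.le x, plusPair_zero_left] at h
    exact h.trans (hdec x)
  -- `C ≥ 0` (take `x = 0`: `0 ≤ m² ≤ C`)
  have hC : 0 ≤ C := by
    have h := key 0
    rw [norm_zero, mul_zero, Real.exp_zero, mul_one] at h
    exact (mul_self_nonneg m).trans h
  -- along the diagonal sites `(n, …, n)`, `‖·‖ ≥ n`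
  have key' : ∀ n : ℕ, m * m ≤ C * Real.exp (-(c * (n : ℝ))) := fun n => by
    set xn : Site d := fun _ => (n : ℤ) with hxn
    have hnorm : (n : ℝ) ≤ ‖xn‖ := by
      have h1 := norm_le_pi_norm xn ⟨0, hd⟩
      rw [hxn, Int.norm_natCast] at h1
      exact h1
    refine (key xn).trans (mul_le_mul_of_nonneg_left ?_ hC)
    rw [neg_mul]
    exact Real.exp_le_exp.2 (neg_le_neg (mul_le_mul_of_nonneg_left hnorm hc.le))
  have ht : Tendsto (fun n : ℕ => C * Real.exp (-(c * (n : ℝ)))) atTop (𝓝 0) := by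
    rw [show (0 : ℝ) = C * 0 by ring]
    exact (Real.tendsto_exp_atBot.comp (tendsto_neg_atTop_atBot.comp
      (tendsto_natCast_atTop_atTop.const_mul_atTop hc))).const_mul C
  have hle : m * m ≤ 0 := ge_of_tendsto' ht key'
  exact mul_self_eq_zero.1 (le_antisymm hle (mul_self_nonneg m))

/-- **`β ∈ dctIsingSet d ⇒ m*(β) = 0`** for `d ≥ 1`: the case `β > 0` is
`spontaneousMagnetization_eq_zero_of_dctIsingPhi_lt_one`, the case `β = 0` is `m*(0) = 0`.
(Duminil-Copin–Tassion 2016, §2.1 with §2.5.) [cite: DuminilCopinTassionCMP2016, §2.1 (β̃_c = β_c) with §2.5] -/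
theorem spontaneousMagnetization_eq_zero_of_mem_dctIsingSet (hd : 1 ≤ d)
    (hT2 : dct_twoPointPlus_exponentialDecay (d := d))
    (hfkg : plusExpect_spinAt_mul_le_plusPair (d := d))
    (hti : plusExpect_spinAt_eq_spontaneousMagnetization (d := d))
    {β : ℝ} (hβD : β ∈ dctIsingSet d) : spontaneousMagnetization d β = 0 := by
  obtain ⟨hβ0, S, h0, hφ⟩ := hβD
  rcases hβ0.eq_or_lt with rfl | hpos
  · exact spontaneousMagnetization_zero d
  · exact spontaneousMagnetization_eq_zero_of_dctIsingPhi_lt_one hd hT2 hfkg hti hpos h0 hφ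

/-! ### Eq. (2.6) above `β̃_c`, from `SharpnessSubcritical.dct_magnetization_lower_bound` -/

/-- **Duminil-Copin–Tassion 2016, eq. (2.6) at `β̃_c`**: granting the §2.4 fact
`dct_magnetization_lower_bound` of `SharpnessSubcritical` (eq. (2.6) with "`β₁ ≥ β̃_c`"
unfolded), for `d ≥ 1`, `dctIsingSet d` bounded above and `β > β̃_c`:
`m*(β) ≥ √((β² - β̃_c²)/β²)`. Proof: every `β₁ ∈ (β̃_c, β]` satisfies the unfolded hypothesis
(`one_le_dctIsingPhi_of_lt`), so `m*(β) ≥ √((β² - β₁²)/β²)`, and `β₁ ↓ β̃_c`. [cite: DuminilCopinTassionCMP2016, eq. (2.6), §2.4 (arXiv:1502.03050 numbering)] -/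
theorem dct_spontaneousMagnetization_lower_bound (hmag : dct_magnetization_lower_bound (d := d))
    (hd : 1 ≤ d) (hD : BddAbove (dctIsingSet d)) {β : ℝ} (hβ : dctIsingCriticalBeta d < β) :
    Real.sqrt ((β ^ 2 - dctIsingCriticalBeta d ^ 2) / β ^ 2) ≤ spontaneousMagnetization d β := by
  have hb : 0 ≤ dctIsingCriticalBeta d := dctIsingCriticalBeta_nonneg d
  have hstep : ∀ {β₁ : ℝ}, dctIsingCriticalBeta d < β₁ → β₁ ≤ β →
      Real.sqrt ((β ^ 2 - β₁ ^ 2) / β ^ 2) ≤ spontaneousMagnetization d β :=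
    fun {β₁} h1 h1β => hmag hd (hb.trans_lt h1) h1β fun β' hβ' S hS =>
      one_le_dctIsingPhi_of_lt hD (h1.trans hβ') S hS
  have htend : Tendsto (fun β₁ : ℝ => Real.sqrt ((β ^ 2 - β₁ ^ 2) / β ^ 2))
      (𝓝[>] dctIsingCriticalBeta d)
      (𝓝 (Real.sqrt ((β ^ 2 - dctIsingCriticalBeta d ^ 2) / β ^ 2))) := by
    refine ((Real.continuous_sqrt.comp ?_).tendsto _).mono_left nhdsWithin_le_nhds
    fun_prop
  refine le_of_tendsto htend ?_
  filter_upwards [Ioo_mem_nhdsGT hβ] with β₁ hβ₁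
  exact hstep hβ₁.1 hβ₁.2.le

/-! ### `β̃_c = β_c` and the mean-field lower bound -/

/-- **`β̃_c ≤ β` whenever `m*(β) > 0`** (`β ≥ 0`, `d ≥ 1`): otherwise `β < β̃_c = sup dctIsingSet`
gives `β' ∈ dctIsingSet` above `β`, hence `β ∈ dctIsingSet` (initial segment) and `m*(β) = 0`.
This is the half "`β_c ≥ β̃_c`" of Duminil-Copin–Tassion's "`β̃_c = β_c`" (§2.1), from items 2–3. [cite: DuminilCopinTassionCMP2016, §2.1 (β̃_c = β_c)] -/
theorem dctIsingCriticalBeta_le_of_spontaneousMagnetization_pos (hd : 1 ≤ d)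
    (hT2 : dct_twoPointPlus_exponentialDecay (d := d))
    (hmono : isingCorr_free_mono_beta (d := d))
    (hgks : ∀ {Λ A : Finset (Site d)} {β h : ℝ} {bc : BoundaryCondition (Site d)},
      gks_one (zdGraph d) (Λ := Λ) (A := A) (β := β) (h := h) (bc := bc))
    (hfkg : plusExpect_spinAt_mul_le_plusPair (d := d))
    (hti : plusExpect_spinAt_eq_spontaneousMagnetization (d := d))
    {β : ℝ} (hβ : 0 ≤ β) (hm : 0 < spontaneousMagnetization d β) :
    dctIsingCriticalBeta d ≤ β := by
  by_contra hlt
  push Not at hlt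
  obtain ⟨β', hβ'D, hββ'⟩ := exists_lt_of_lt_csSup (dctIsingSet_nonempty d) hlt
  have hβD : β ∈ dctIsingSet d := mem_dctIsingSet_of_le hmono hgks hβ'D hβ hββ'.le
  have h0 := spontaneousMagnetization_eq_zero_of_mem_dctIsingSet hd hT2 hfkg hti hβD
  exact hm.ne' h0

/-- **`β̃_c < ∞` for `d ≥ 2`**: if `dctIsingSet d` were unbounded it would be all of `[0, ∞)`
(initial segment), so `m*(β) = 0` for every `β ≥ 0` by DCT's exponential decay, contradicting
Peierls' theorem `exists_spontaneousMagnetization_pos` (`m*(β) > 0` for some `β`, `d ≥ 2`).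
(Duminil-Copin–Tassion 2016, §2.1: on `ℤ^d`, `d ≥ 2`, `β̃_c = β_c < ∞`.) [cite: DuminilCopinTassionCMP2016, §2.1 (β̃_c = β_c)] -/
theorem bddAbove_dctIsingSet (hd : 2 ≤ d)
    (hT2 : dct_twoPointPlus_exponentialDecay (d := d))
    (hmono : isingCorr_free_mono_beta (d := d))
    (hgks : ∀ {Λ A : Finset (Site d)} {β h : ℝ} {bc : BoundaryCondition (Site d)},
      gks_one (zdGraph d) (Λ := Λ) (A := A) (β := β) (h := h) (bc := bc))
    (hfkg : plusExpect_spinAt_mul_le_plusPair (d := d))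
    (hti : plusExpect_spinAt_eq_spontaneousMagnetization (d := d))
    (hpeierls : exists_spontaneousMagnetization_pos (d := d)) :
    BddAbove (dctIsingSet d) := by
  by_contra hnot
  obtain ⟨β, hβ0, hm⟩ := hpeierls hd
  obtain ⟨β', hβ'D, hββ'⟩ := not_bddAbove_iff.1 hnot β
  have hβD : β ∈ dctIsingSet d := mem_dctIsingSet_of_le hmono hgks hβ'D hβ0 hββ'.le
  exact hm.ne' (spontaneousMagnetization_eq_zero_of_mem_dctIsingSet (le_trans one_le_two hd)
    hT2 hfkg hti hβD)

/-- **"This directly implies `β̃_c = β_c`"** (Duminil-Copin–Tassion 2016, §2.1), for the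
nearest-neighbour model on `ℤ^d`, `d ≥ 2`, with the tree's `β_c = inf{β ≥ 0 | m*(β) > 0}`
(Friedli–Velenik 2017, Def. 3.32): `β_c ≤ β̃_c` since `m*(β) ≥ √((β²-β̃_c²)/β²) > 0` for
`β > β̃_c` (eq. (2.6)), and `β̃_c ≤ β_c` since `m* = 0` on `dctIsingSet ⊇ [0, β̃_c)`. All inputs
are named facts of the tree, threaded as hypotheses. [cite: DuminilCopinTassionCMP2016, §2.1 (β̃_c = β_c)] -/
theorem dctIsingCriticalBeta_eq_criticalBeta (hd : 2 ≤ d)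
    (hmag : dct_magnetization_lower_bound (d := d))
    (hT2 : dct_twoPointPlus_exponentialDecay (d := d))
    (hmono : isingCorr_free_mono_beta (d := d))
    (hgks : ∀ {Λ A : Finset (Site d)} {β h : ℝ} {bc : BoundaryCondition (Site d)},
      gks_one (zdGraph d) (Λ := Λ) (A := A) (β := β) (h := h) (bc := bc))
    (hfkg : plusExpect_spinAt_mul_le_plusPair (d := d))
    (hti : plusExpect_spinAt_eq_spontaneousMagnetization (d := d))
    (hpeierls : exists_spontaneousMagnetization_pos (d := d)) :
    dctIsingCriticalBeta d = criticalBeta d := by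
  have hd1 : 1 ≤ d := le_trans one_le_two hd
  have hD : BddAbove (dctIsingSet d) := bddAbove_dctIsingSet hd hT2 hmono hgks hfkg hti hpeierls
  -- `m*(β) > 0` for `β > β̃_c`
  have hpos : ∀ β : ℝ, dctIsingCriticalBeta d < β → 0 < spontaneousMagnetization d β := by
    intro β hβ
    have hβpos : 0 < β := (dctIsingCriticalBeta_nonneg d).trans_lt hβ
    have hsq : dctIsingCriticalBeta d ^ 2 < β ^ 2 :=
      pow_lt_pow_left₀ hβ (dctIsingCriticalBeta_nonneg d) two_ne_zero
    have hroot : 0 < Real.sqrt ((β ^ 2 - dctIsingCriticalBeta d ^ 2) / β ^ 2) :=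
      Real.sqrt_pos.2 (div_pos (sub_pos.2 hsq) (pow_pos hβpos 2))
    exact hroot.trans_le (dct_spontaneousMagnetization_lower_bound hmag hd1 hD hβ)
  have hMne : ({β : ℝ | 0 ≤ β ∧ 0 < spontaneousMagnetization d β}).Nonempty :=
    ⟨dctIsingCriticalBeta d + 1, by linarith [dctIsingCriticalBeta_nonneg d], hpos _ (lt_add_one _)⟩
  refine le_antisymm ?_ ?_
  · -- `β̃_c ≤ β_c`: every `β` with `m*(β) > 0` is `≥ β̃_c`
    exact le_csInf hMne fun β hβ =>
      dctIsingCriticalBeta_le_of_spontaneousMagnetization_pos hd1 hT2 hmono hgks hfkg hti hβ.1 hβ.2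
  · -- `β_c ≤ β̃_c`: `β_c ≤ β` for every `β > β̃_c`
    refine le_of_forall_gt_imp_ge_of_dense fun β hβ => ?_
    exact csInf_le ⟨0, fun _ h => h.1⟩ ⟨(dctIsingCriticalBeta_nonneg d).trans hβ.le, hpos β hβ⟩

/-- **crit-ising.S08 (mean-field lower bound) from the Duminil-Copin–Tassion route.** Granting
DCT's eq. (2.6) (`dct_magnetization_lower_bound`), the plus-state §2.5 decay
(`dct_twoPointPlus_exponentialDecay`), the monotonicity of free correlations in `β`, GKS I, FKG in
the plus state, `⟨σ_x⟩⁺ = m*` and Peierls (all named facts or theorems of the tree, threaded as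
hypotheses; see `meanField_lower_bound_of_dct_facts`), the target fact `meanField_lower_bound`
holds with `ε = 1` and `c = 1/√(β_c + 1)`: for `β ∈ (β_c, β_c+1)`, `β̃_c = β_c` and
`m*(β) ≥ √((β²-β_c²)/β²) ≥ √((β-β_c)/β) ≥ √(β-β_c)/√(β_c+1)`.
(Duminil-Copin–Tassion, CMP 343 (2016), Thm. 1.2; Aizenman–Barsky–Fernández, J. Stat. Phys. 47
(1987), Thm. 1 (ii).) [cite: DuminilCopinTassionCMP2016, Thm. 1.2 (arXiv: Thm. 2.1, first item) and §2.1] -/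
theorem meanField_lower_bound_of_dct
    (hmag : dct_magnetization_lower_bound (d := d))
    (hT2 : dct_twoPointPlus_exponentialDecay (d := d))
    (hmono : isingCorr_free_mono_beta (d := d))
    (hgks : ∀ {Λ A : Finset (Site d)} {β h : ℝ} {bc : BoundaryCondition (Site d)},
      gks_one (zdGraph d) (Λ := Λ) (A := A) (β := β) (h := h) (bc := bc))
    (hfkg : plusExpect_spinAt_mul_le_plusPair (d := d))
    (hti : plusExpect_spinAt_eq_spontaneousMagnetization (d := d))
    (hpeierls : exists_spontaneousMagnetization_pos (d := d)) :
    meanField_lower_bound (d := d) := by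
  intro hd
  have hd1 : 1 ≤ d := le_trans one_le_two hd
  have hD : BddAbove (dctIsingSet d) := bddAbove_dctIsingSet hd hT2 hmono hgks hfkg hti hpeierls
  have heq : dctIsingCriticalBeta d = criticalBeta d :=
    dctIsingCriticalBeta_eq_criticalBeta hd hmag hT2 hmono hgks hfkg hti hpeierls
  have hβc : 0 ≤ criticalBeta d := criticalBeta_nonneg d
  refine ⟨(Real.sqrt (criticalBeta d + 1))⁻¹, by positivity, 1, one_pos, fun β hβ => ?_⟩
  obtain ⟨hβ1, hβ2⟩ := hβ
  have hβpos : 0 < β := hβc.trans_lt hβ1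
  have hbound : Real.sqrt ((β ^ 2 - criticalBeta d ^ 2) / β ^ 2) ≤ spontaneousMagnetization d β := by
    rw [← heq] at hβ1 ⊢
    exact dct_spontaneousMagnetization_lower_bound hmag hd1 hD hβ1
  refine le_trans ?_ hbound
  -- `(√(β_c+1))⁻¹ √(β-β_c) = √((β_c+1)⁻¹ (β-β_c)) ≤ √((β²-β_c²)/β²)`
  rw [← Real.sqrt_inv, ← Real.sqrt_mul (inv_nonneg.2 (by linarith)) (β - criticalBeta d)]
  refine Real.sqrt_le_sqrt ?_
  have h1 : (criticalBeta d + 1)⁻¹ * (β - criticalBeta d) ≤ (β - criticalBeta d) / β := by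
    rw [inv_mul_eq_div]
    exact div_le_div_of_nonneg_left (by linarith) hβpos hβ2.le
  have h2 : (β - criticalBeta d) / β ≤ (β ^ 2 - criticalBeta d ^ 2) / β ^ 2 := by
    rw [div_le_div_iff₀ hβpos (pow_pos hβpos 2)]
    nlinarith [mul_nonneg hβc (sub_nonneg.2 hβ1.le), hβpos]
  exact h1.trans h2

/-- **crit-ising.S08 from the two DCT facts and Peierls**: `meanField_lower_bound_of_dct` fed with
the tree theorems `isingCorr_free_mono_beta_holds` (GKS II), `gks_one_holds`
(`GriffithsKellySherman`), `plusExpect_spinAt_mul_le_plusPair_holds` and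
`plusExpect_spinAt_eq_spontaneousMagnetization_holds` (`PlusStateFKG`, FKG). Remaining
hypotheses: DCT eq. (2.6) (`SharpnessSubcritical.dct_magnetization_lower_bound`), the plus-state
§2.5 decay (proved from Lemma 2.7 in `MeanFieldBoundProofs`) and Peierls (the tree theorem
`IsingPeierls.exists_spontaneousMagnetization_pos_holds`; see
`MeanFieldBoundProofs.meanField_lower_bound_of_dct_eq26_lemma27`)
(`exists_spontaneousMagnetization_pos`). [cite: DuminilCopinTassionCMP2016, Thm. 1.2 (arXiv: Thm. 2.1, first item) and §2.1] -/
theorem meanField_lower_bound_of_dct_facts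
    (hmag : dct_magnetization_lower_bound (d := d))
    (hT2 : dct_twoPointPlus_exponentialDecay (d := d))
    (hpeierls : exists_spontaneousMagnetization_pos (d := d)) :
    meanField_lower_bound (d := d) :=
  meanField_lower_bound_of_dct hmag hT2 isingCorr_free_mono_beta_holds
    (fun {_ _ _ _ _} => Literature.Probability.LatticeModels.GriffithsKellySherman.gks_one_holds (zdGraph d))
    plusExpect_spinAt_mul_le_plusPair_holds plusExpect_spinAt_eq_spontaneousMagnetization_holds
    hpeierls

/-! ### The same assembly from "`m* = 0` on `dctIsingSet`" (any route to `β̃_c ≤ β_c`) -/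

/-- **`β̃_c < ∞` for `d ≥ 2` from `m* = 0` on `dctIsingSet d` and Peierls** (as
`bddAbove_dctIsingSet`, with the vanishing of `m*` on `dctIsingSet d` as a black box: it follows
from the plus-state §2.5 decay, `spontaneousMagnetization_eq_zero_of_mem_dctIsingSet`, or from any
other route, e.g. free-state decay + GHS). [cite: DuminilCopinTassionCMP2016, §2.1 (β̃_c = β_c)] -/
theorem bddAbove_dctIsingSet_of_zero (hd : 2 ≤ d) (hmono : isingCorr_free_mono_beta (d := d))
    (hgks : ∀ {Λ A : Finset (Site d)} {β h : ℝ} {bc : BoundaryCondition (Site d)},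
      gks_one (zdGraph d) (Λ := Λ) (A := A) (β := β) (h := h) (bc := bc))
    (hzero : ∀ β ∈ dctIsingSet d, spontaneousMagnetization d β = 0)
    (hpeierls : exists_spontaneousMagnetization_pos (d := d)) :
    BddAbove (dctIsingSet d) := by
  by_contra hnot
  obtain ⟨β, hβ0, hm⟩ := hpeierls hd
  obtain ⟨β', hβ'D, hββ'⟩ := not_bddAbove_iff.1 hnot β
  exact hm.ne' (hzero β (mem_dctIsingSet_of_le hmono hgks hβ'D hβ0 hββ'.le))

/-- **`β̃_c = β_c` from eq. (2.6), "`m* = 0` on `dctIsingSet`", and Peierls** (`d ≥ 2`). [cite: DuminilCopinTassionCMP2016, §2.1 (β̃_c = β_c)] -/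
theorem dctIsingCriticalBeta_eq_criticalBeta_of_zero (hd : 2 ≤ d)
    (hmag : dct_magnetization_lower_bound (d := d))
    (hmono : isingCorr_free_mono_beta (d := d))
    (hgks : ∀ {Λ A : Finset (Site d)} {β h : ℝ} {bc : BoundaryCondition (Site d)},
      gks_one (zdGraph d) (Λ := Λ) (A := A) (β := β) (h := h) (bc := bc))
    (hzero : ∀ β ∈ dctIsingSet d, spontaneousMagnetization d β = 0)
    (hpeierls : exists_spontaneousMagnetization_pos (d := d)) :
    dctIsingCriticalBeta d = criticalBeta d := by
  have hd1 : 1 ≤ d := le_trans one_le_two hd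
  have hD : BddAbove (dctIsingSet d) := bddAbove_dctIsingSet_of_zero hd hmono hgks hzero hpeierls
  have hpos : ∀ β : ℝ, dctIsingCriticalBeta d < β → 0 < spontaneousMagnetization d β := by
    intro β hβ
    have hβpos : 0 < β := (dctIsingCriticalBeta_nonneg d).trans_lt hβ
    have hsq : dctIsingCriticalBeta d ^ 2 < β ^ 2 :=
      pow_lt_pow_left₀ hβ (dctIsingCriticalBeta_nonneg d) two_ne_zero
    have hroot : 0 < Real.sqrt ((β ^ 2 - dctIsingCriticalBeta d ^ 2) / β ^ 2) :=
      Real.sqrt_pos.2 (div_pos (sub_pos.2 hsq) (pow_pos hβpos 2))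
    exact hroot.trans_le (dct_spontaneousMagnetization_lower_bound hmag hd1 hD hβ)
  have hMne : ({β : ℝ | 0 ≤ β ∧ 0 < spontaneousMagnetization d β}).Nonempty :=
    ⟨dctIsingCriticalBeta d + 1, by linarith [dctIsingCriticalBeta_nonneg d], hpos _ (lt_add_one _)⟩
  refine le_antisymm ?_ ?_
  · refine le_csInf hMne fun β hβ => ?_
    by_contra hlt
    push Not at hlt
    obtain ⟨β', hβ'D, hββ'⟩ := exists_lt_of_lt_csSup (dctIsingSet_nonempty d) hlt
    exact hβ.2.ne' (hzero β (mem_dctIsingSet_of_le hmono hgks hβ'D hβ.1 hββ'.le))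
  · refine le_of_forall_gt_imp_ge_of_dense fun β hβ => ?_
    exact csInf_le ⟨0, fun _ h => h.1⟩ ⟨(dctIsingCriticalBeta_nonneg d).trans hβ.le, hpos β hβ⟩

/-- **crit-ising.S08 from eq. (2.6), "`m* = 0` on `dctIsingSet`", and Peierls** (the monotonicity
and GKS I inputs being the tree theorems `isingCorr_free_mono_beta_holds`, `gks_one_holds`): the
assembly `meanField_lower_bound_of_dct` with the plus-state §2.5 decay replaced by its only use,
the vanishing of `m*` on `dctIsingSet d` (i.e. `β̃_c ≤ β_c`), so that any route to the latter —
DCT's plus-state Lemma 2.7, or the free-state decay of `SharpnessSubcritical` combined with a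
GHS-type bound `m*(β) = 0` whenever `∑_x ⟨σ₀σ_x⟩^∅_β < ∞` — closes crit-ising.S08 together with
eq. (2.6). [cite: DuminilCopinTassionCMP2016, Thm. 1.2 (arXiv: Thm. 2.1, first item) and §2.1] -/
theorem meanField_lower_bound_of_zero_on_dctIsingSet
    (hmag : dct_magnetization_lower_bound (d := d))
    (hzero : ∀ β ∈ dctIsingSet d, spontaneousMagnetization d β = 0)
    (hpeierls : exists_spontaneousMagnetization_pos (d := d)) :
    meanField_lower_bound (d := d) := by
  intro hd
  have hgks : ∀ {Λ A : Finset (Site d)} {β h : ℝ} {bc : BoundaryCondition (Site d)},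
      gks_one (zdGraph d) (Λ := Λ) (A := A) (β := β) (h := h) (bc := bc) :=
    fun {_ _ _ _ _} => Literature.Probability.LatticeModels.GriffithsKellySherman.gks_one_holds (zdGraph d)
  have hd1 : 1 ≤ d := le_trans one_le_two hd
  have hD : BddAbove (dctIsingSet d) :=
    bddAbove_dctIsingSet_of_zero hd isingCorr_free_mono_beta_holds hgks hzero hpeierls
  have heq : dctIsingCriticalBeta d = criticalBeta d :=
    dctIsingCriticalBeta_eq_criticalBeta_of_zero hd hmag isingCorr_free_mono_beta_holds hgks hzero
      hpeierls
  have hβc : 0 ≤ criticalBeta d := criticalBeta_nonneg d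
  refine ⟨(Real.sqrt (criticalBeta d + 1))⁻¹, by positivity, 1, one_pos, fun β hβ => ?_⟩
  obtain ⟨hβ1, hβ2⟩ := hβ
  have hβpos : 0 < β := hβc.trans_lt hβ1
  have hbound : Real.sqrt ((β ^ 2 - criticalBeta d ^ 2) / β ^ 2) ≤ spontaneousMagnetization d β := by
    rw [← heq] at hβ1 ⊢
    exact dct_spontaneousMagnetization_lower_bound hmag hd1 hD hβ1
  refine le_trans ?_ hbound
  rw [← Real.sqrt_inv, ← Real.sqrt_mul (inv_nonneg.2 (by linarith)) (β - criticalBeta d)]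
  refine Real.sqrt_le_sqrt ?_
  have h1 : (criticalBeta d + 1)⁻¹ * (β - criticalBeta d) ≤ (β - criticalBeta d) / β := by
    rw [inv_mul_eq_div]
    exact div_le_div_of_nonneg_left (by linarith) hβpos hβ2.le
  have h2 : (β - criticalBeta d) / β ≤ (β ^ 2 - criticalBeta d ^ 2) / β ^ 2 := by
    rw [div_le_div_iff₀ hβpos (pow_pos hβpos 2)]
    nlinarith [mul_nonneg hβc (sub_nonneg.2 hβ1.le), hβpos]
  exact h1.trans h2

end Literature.Probability.LatticeModels
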